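import Literature.Computability.MetaComplexity.Frege
import Literature.Computability.Complexity.Classes
import Literature.Computability.Complexity.CNF
import Literature.Computability.Complexity.RandomizedProofs
import Literature.Computability.Complexity.BranchingFn

/-!
# `EFNotPOptimal`: soundness of the Frege system is load-bearing

Negative lemmas for crux `stmt-PneNP-18942` (`EFNotPOptimal`, route `PneNP/EfNotPOptimal`;
refuter crux-attack seat at birth). The crux reads

  `∀ F, IsFrege F → ∃ H ⊆ TAUT, ⟦H⟧ ∈ P ∧ ¬ ∃ f p-time, ∀ φ ∈ H, F.IsEFProofOf (f φ) φ`

with `IsFrege F = F.IsSound ∧ F.IsImplicationallyComplete`. We record which half of `IsFrege` any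
proof must use:

* `efNotPOptimal_false_without_isSound`: the crux with `IsFrege F` weakened to
  `F.IsImplicationallyComplete` is FALSE — the one-axiom scheme `⊢ A` (Cook–Reckhow's example of an
  unsound complete inference system) proves every formula in one line, and `φ ↦ [φ]` is
  polynomial-time computable w.r.t. the route's encoders (`polyTimeComputable_singleton`), so NO
  set `H` (easy or not, tautologous or not) escapes it. Hence every proof of the crux must use
  `F.IsSound`.
* By contrast the empty rule list (sound, incomplete) satisfies the crux's conclusion for a
  trivial reason (`not_isEFProofOf_nil_rules`: extended Frege over no rules proves nothing, since
  the last line of an EF-proof of `φ` would be an extension axiom `p ↔ ψ` with `p ∉ vars φ`), so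
  dropping completeness does not falsify the crux at the degenerate instance; completeness is what
  makes every tautology EF_F-provable (`exists_isEFProofOf_of_isFrege`), i.e. what forces a
  witness `H` to be a genuinely hard EASY sequence (Krajíček–Pudlák) rather than an unprovable one,
  and the clause `⟦H⟧ ∈ P` cannot be met by `H = ∅` (`exists_polyTime_vacuous`).

No definition and no positive Theses conclusion is introduced here (D-0016 negative lane).
-/

-- `Summit.PneNP.PneNP.…` duplicates `PneNP` BY DESIGN (single-problem summit, D-0017); the Summits
-- library sets this option globally (lakefile), repeated here so a standalone check is warning-free.
set_option linter.dupNamespace false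

namespace Summit.PneNP.PneNP.Theorems.EFNotPOptimal.Negative

open _root_.Computability Literature.Computability.MetaComplexity Literature.Computability.Complexity

/-! Below, `⟨[⟨[], var 0⟩]⟩ : FregeSystem` is the one-rule inference system consisting of the
axiom scheme `⊢ A` (`A = var 0`): implicationally complete, unsound — Cook–Reckhow's example after
their Def. 2.2. It is written out at each use (no definition is introduced on the negative lane). -/

/-- In `⊢ A` every formula is inferred (from any earlier lines) in one step. -/
theorem axiomA_isInferred (prev : List (PropForm ℕ)) (θ : PropForm ℕ) :
    FregeSystem.IsInferred (FregeSystem.mk [FregeRule.mk [] (PropForm.var 0)]) prev θ :=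
  ⟨⟨[], PropForm.var 0⟩, by simp, fun _ => θ, rfl, fun p hp => by simp at hp⟩

/-- `[φ]` is an (extended) `⊢ A`-proof of `φ`. -/
theorem axiomA_isEFProofOf (φ : PropForm ℕ) :
    FregeSystem.IsEFProofOf (FregeSystem.mk [FregeRule.mk [] (PropForm.var 0)]) [φ] φ :=
  ⟨fun _ _ => Or.inl (axiomA_isInferred _ _), rfl⟩

/-- `⊢ A` is implicationally complete (it derives every formula from any hypotheses). -/
theorem axiomA_isImplicationallyComplete :
    FregeSystem.IsImplicationallyComplete (FregeSystem.mk [FregeRule.mk [] (PropForm.var 0)]) :=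
  fun _ φ _ => ⟨[φ], fun _ _ => Or.inr (axiomA_isInferred _ _), rfl⟩

/-- `⊢ A` is not sound (it proves `var 0`, false at the all-false assignment), hence not Frege —
the witness lives exactly in the gap opened by dropping `IsSound`. -/
theorem not_isSound_axiomA :
    ¬ FregeSystem.IsSound (FregeSystem.mk [FregeRule.mk [] (PropForm.var 0)]) := by
  intro h
  have := h ⟨[], PropForm.var 0⟩ (by simp) (fun _ => false) (fun p hp => by simp at hp)
  simp [PropForm.eval] at this

/-- The wrapping map `φ ↦ [φ]` is polynomial-time computable from `encodingPropForm` to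
`encodingPropForm.listBool`: on strings it is `w ↦ ⟨1¹, ⟨w, []⟩⟩`, a fan-out of constants and
the identity. -/
theorem polyTimeComputable_singleton :
    PolyTimeComputable encodingPropForm.encode encodingPropForm.listBool.encode
      (fun φ : PropForm ℕ => [φ]) := by
  have hFP : fanoutFn (fun _ : List Bool => unaryEncodeNat 1)
      (fanoutFn (fun w : List Bool => w) (fun _ : List Bool => ([] : List Bool))) ∈ FP :=
    fanoutFn_mem_FP (const_mem_FP _) (fanoutFn_mem_FP (PolyTimeComputable.id _) (const_mem_FP _))
  refine PolyTimeComputable.of_encode_eq (ea := id) (eb := id)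
    (f := fanoutFn (fun _ : List Bool => unaryEncodeNat 1)
      (fanoutFn (fun w : List Bool => w) (fun _ : List Bool => ([] : List Bool))))
    encodingPropForm.encode (fun _ => rfl) (fun φ => ?_) hFP
  simp [fanoutFn_apply, Computability.Encoding.listBool]

/-- **Soundness is load-bearing in `EFNotPOptimal`.** The crux with `IsFrege F` weakened to
implicational completeness alone is false: for `F = ⊢ A` and ANY set `H`, the polynomial-time
map `φ ↦ [φ]` outputs `EF_F`-proofs of every member of `H`. -/
theorem efNotPOptimal_false_without_isSound :
    ¬ ∀ F : FregeSystem, F.IsImplicationallyComplete →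
        ∃ H : Set (PropForm ℕ), (∀ φ ∈ H, φ.IsTautology) ∧
          encodingPropForm.toLanguage H ∈ Classes.P ∧
          ¬ ∃ f : PropForm ℕ → List (PropForm ℕ),
            PolyTimeComputable encodingPropForm.encode encodingPropForm.listBool.encode f ∧
            ∀ φ ∈ H, F.IsEFProofOf (f φ) φ := by
  intro h
  obtain ⟨H, -, -, hno⟩ :=
    h (FregeSystem.mk [FregeRule.mk [] (PropForm.var 0)]) axiomA_isImplicationallyComplete
  exact hno ⟨fun φ => [φ], polyTimeComputable_singleton, fun φ _ => axiomA_isEFProofOf φ⟩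

/-- Extended Frege over the EMPTY rule list proves nothing: the last line of an EF-proof of `φ`
would have to be an extension axiom `p ↔ ψ`, whose variable `p` occurs in the line but must not
occur in `φ` — yet the last line IS `φ`. (So at the sound-but-incomplete degenerate instance the
crux's conclusion holds trivially, with any nonempty easy `H ⊆ TAUT`.) -/
theorem not_isEFProofOf_nil_rules (π : List (PropForm ℕ)) (φ : PropForm ℕ) :
    ¬ (⟨[]⟩ : FregeSystem).IsEFProofOf π φ := by
  rintro ⟨hder, hlast⟩
  have hne : π ≠ [] := by rintro rfl; simp at hlast
  have hlen : π.length - 1 < π.length := Nat.sub_lt (List.length_pos_iff.2 hne) Nat.one_pos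
  have hφ : π[π.length - 1] = φ := by
    rw [List.getLast?_eq_getElem?] at hlast
    exact Option.some_injective _ ((List.getElem?_eq_getElem hlen).symm.trans hlast)
  rcases hder (π.length - 1) hlen with ⟨r, hr, -⟩ | ⟨p, ψ, hθ, -, hpφ, -⟩
  · simp at hr
  · rw [hφ] at hθ
    apply hpφ
    rw [hθ]
    simp [PropForm.biimp, PropForm.vars]

/-- For a Frege system every tautology has an EF_F-proof (implicational completeness from no
hypotheses, read as an EF-derivation without extension axioms): a witness `H` for the crux can
never work by unprovability, only by the hardness of FINDING proofs. -/
theorem exists_isEFProofOf_of_isFrege {F : FregeSystem} (hF : IsFrege F) {φ : PropForm ℕ}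
    (hφ : φ.IsTautology) : ∃ π, F.IsEFProofOf π φ := by
  obtain ⟨π, hπ, hlast⟩ := hF.2 ∅ φ (fun σ _ => hφ σ)
  refine ⟨π, fun k hk => ?_, hlast⟩
  rcases hπ k hk with h | h
  · simp at h
  · exact Or.inl h

/-- The witness `H` of the crux cannot be empty: at `H = ∅` the inner clause says that NO map
`PropForm ℕ → List (PropForm ℕ)` is polynomial-time computable, refuted by a constant map. -/
theorem exists_polyTime_vacuous (F : FregeSystem) :
    ∃ f : PropForm ℕ → List (PropForm ℕ),
      PolyTimeComputable encodingPropForm.encode encodingPropForm.listBool.encode f ∧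
      ∀ φ ∈ (∅ : Set (PropForm ℕ)), F.IsEFProofOf (f φ) φ :=
  ⟨fun φ => [φ], polyTimeComputable_singleton, fun φ h => (Set.notMem_empty φ h).elim⟩

end Summit.PneNP.PneNP.Theorems.EFNotPOptimal.Negative
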